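import Summits.QuantumFields.BalabanUV.Beta.SymCorrectorMixedGauge
import Summits.QuantumFields.BalabanUV.Beta.SymCorrectorLiteralW
import Summits.QuantumFields.BalabanUV.Beta.KernelWardResponse

/-!
# `BalabanUV.Beta.SymCorrectorW2Gauge` — binder row D1, road «BF-x» junction (J1), brick TT14 (capstone of TT10–TT13): **THE SECOND-ORDER BACKGROUND FAMILY OF
# THE CHART-TRANSPORTED KERNEL IS THE RAW FAMILY PLUS THE OWNER's `Wmix`-PIECES (for the FULL first-order vertex `dM = vertexOfK + vertexOfM`), THE `Wgg`-PIECE,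
# AND ONE DISPLAYED RESPONSE WORD** — TT8 `SymCorrectorLiteralW.W2OfK_conj_psiKS′` with every slot transport written as a diagonal contact under the rooted slot
# Ward letters (hypotheses) of the four tables `S`, `S₂` (both slots), `M₂` (field slot)

THE MATHEMATICS.  TT8 writes, for a spread `K`, an in-block root offset `r` (`Ψ̂ := psiKS r n`) and localised tables,
`W2OfK (Ψ̂KΨ̂ᵀ) n S M S₂ M₂ μ y ν y′ = vertex2OfK K n (slot∘slot S₂) μ y ν y′ + mixOfK K n (slot M₂) μ y ν y′ + mixOfK K n (slot M₂) ν y′ μ y + dM Y n (slot S) M μ y`,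
`Y := −(K∘(Ψ̂ᵀ∘dM K n (slot S) M ν y′∘Ψ̂)∘K)`, `slot := slotPsiS r n`.  Under the POINTWISE rooted slot letters (the OWNER's `_of_letters_smul` shape; HYPOTHESES)
`hS : divV S u = ξ • conjV 𝕄 (D_u)`, `hL`∕`hR : divV (S₂ first∕second slot) = ξ₁∕ξ₂ • conjV (S ·) (D_u)` (partner = the first-order table), `hM : divV (M₂ field slot) = ξm • conjV (M ρ w) (D_u)`,
`D_u := diagK (legInd ϱ u)`, the bricks TT12 (`vertex2OfK_slotPsiS₂_eq_add_contacts_of_letters`), TT13 (`mixOfK_slotPsiS_eq_add_contact_of_letters`) and TT10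
(`vertexOfK_slotPsiS_eq_add_conjV_of_letters`, `vertexOfK_faceFamily_eq_conjV_of_letters`) give
**`W2OfK (Ψ̂KΨ̂ᵀ) n S M S₂ M₂ μ y ν y′ = (vertex2OfK K n S₂ μ y ν y′ + mixOfK K n M₂ μ y ν y′ + mixOfK K n M₂ ν y′ μ y + dM Y′ n S M μ y)`**
**` + (conjV (vertexOfK K n S ν y′) (Θ₁ μ y) + conjV (vertexOfK K n S μ y) (Θ₂ ν y′) + conjV (vertexOfM K n M ν y′) (Θm μ y) + conjV (vertexOfM K n M μ y) (Θm ν y′))`** (the `Wmix`-pieces)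
**` + conjV (conjV 𝕄 (Θ ν y′)) (Θ₁ μ y)`** (the `Wgg`-piece) **` + conjV 𝕄 (Θ[Y′] μ y)`** (the face contact of the RESPONSE kernel's own column),
with `Y′ := −(K∘(Ψ̂ᵀ∘(dM K n S M ν y′ + conjV 𝕄 (Θ ν y′))∘Ψ̂)∘K)` (the inner slot transported too) and the dressed block symbols
`Θᵢ[K] μ y := diagK (z b ↦ Σ_α Σ_{x ∈ blockSitesF n (blk n (legSite ϱ z b))} colH K n μ y α x·(ξᵢ·faceWt r n α x))`.  With `ξ₁ = ξ₂ = ξm = ξ` the `Wmix`-pieces are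
`conjV (dM K n S M ν y′) (Θ μ y) + conjV (dM K n S M μ y) (Θ ν y′)` = `hessKer_columnGauge`'s `Wmix μ y ν y′` at `V := dM`, `Λ := −Θ` (TT11 `mixed_eq_Wmix`), and the
`Wgg`-piece is its `Wgg μ y ν y′` (TT11 `faceFace_eq_Wgg`).  What is NOT a gauge letter is DISPLAYED: the response word `dM Y′ n S M μ y` against the reference's
`dM (K2OfK K n S M ν y′) n S M μ y` (leg dressing `Ψ̂ᵀ·Ψ̂` and the inner contact inside `Y′`) and the extra first-order-shaped contact `conjV 𝕄 (Θ[Y′] μ y)`.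
* §1 `decays_of_loc` (a localised kernel decays — an2's `KernelWardResponse.decays_of_biLoc` in `∃`-form: the additivity socket for the response kernel), `loc_faceGen`; table bounds BY NAME (`ChartConjugationReflection.abs_le_of_locStencil`, `KernelWard.bdd_of_biLoc`);
* §2 `dM_slotPsiS_eq_add_of_letters` (any spread `Y`: `dM Y n (slot S) M μ y = dM Y n S M μ y + conjV 𝕄 (Θ[Y] μ y)`), `loc_responseKernel`;
* §3 **`W2OfK_conj_psiKS_eq_add_gauge_letters`** (the display above).

HONEST DEPENDENCY (cell records, verbatim): «continuum YM on T⁴ ⇐ BetaPertH ∧ nine spine estimates (0/9 proved); BetaPertH ⇐ (D1) ∧ (D4) ∧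
CAP+tail; G-an2-4 gates asym, D1 and NE2/3/4.»  HONEST FRAMING (cell contract, verbatim): «discharging `BetaPertH` makes Bałaban's UV stability
UNCONDITIONAL — a real constructive-QFT result; it is NOT the continuum limit and NOT the Clay problem.»  THIS MODULE DISCHARGES NOTHING of (K), of
(J1)'s row, of D1 or of the wall: [folklore] identities between OUR kernels BY NAME; the four letters are HYPOTHESES (no table's letter proved here); the
response word and the extra contact are DISPLAYED, not cancelled, not sized.  No definition, no `def … : Prop`, nothing cited, 0 sorry.  0∕4 row-D1 binders;
(K) NOT closed; (J1) = ONE OPEN ROW; NOT D1, NEVER «G-an2-4 closed», NOT `BetaPertH`, NOT continuum, NOT Clay.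

ABSOLUTE RULE (cell charter, verbatim): «No internally-minted statement may enter as a cited fact. Every hypothesis is either kernel-proved in this
package or a verbatim quotation of a PUBLISHED theorem with page reference. The manuscript(s) under audit are NOT citable for their own disputed
steps — they are the thing under adjudication; programme-internal (2001/route/tribunal) claims are never citable.»

D1 formalisation swarm LEAF 03 (`b2b-balaban-beta-d1-formalise-leaf-03`, gen 30), 2026-08-23; over TT8∕TT10∕TT12∕TT13 (leaf-03), an2's `SecondOrderResponse`,
an5∕an2's `ChartConjugationReflection.vertexOfK_add` BY NAME; no existing file touched.
-/

open Finset
open scoped BigOperators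
open Literature.MathematicalPhysics.QuantumFieldTheory
open Literature.MathematicalPhysics.QuantumFieldTheory.Balaban1983to89
open Literature.MathematicalPhysics.QuantumFieldTheory.Balaban1983to89.Beta
open B12Sec2to5 (l1 l1_nonneg)
open ExpKernelCalculus (MKer Decays BiLoc VertexFamily comp l1_sub_triangle l1_sub_symm)
open OneStepResolventKernel (Fib wsum LocStencil)
open OneStepKernelFamily (colH vertexOfK)
open SecondOrderResponse (vertexOfM dM dM_apply K2OfK mixOfK W2OfK vertex2OfK LocStencilFM)
open BalabanCompositeJets (LocStencil₂)
open KernelWard (divV bdd_of_biLoc)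
open AffineAveraging (Site box)
open AveragingContours (blk)
open Summit.QuantumFields.BalabanUV.Beta.TameKernelCalculus (Spr Loc trK Spr.comp_loc Loc.comp_spr Loc.add Loc.neg Spr.trK decays_of_le)
open Summit.QuantumFields.BalabanUV.Beta.ChartConjugation (conjV loc_conjV)
open Summit.QuantumFields.BalabanUV.Beta.ChartConjugationReflection (vertexOfK_add abs_le_of_locStencil)
open Summit.QuantumFields.BalabanUV.Beta.BorderedHessian (diagK diagK_apply conjV_diagK_apply)
open Summit.QuantumFields.BalabanUV.Beta.AveragingWardRootedStencils (legSite legInd)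
open Summit.QuantumFields.BalabanUV.Beta.CompositeCorrectorLocality (blockSitesF)
open Summit.QuantumFields.BalabanUV.Beta.SymCorrectorKernel (psiKS spr_psiKS)
open Summit.QuantumFields.BalabanUV.Beta.SymCorrectorFace (faceWt faceWtSum faceWtSum_nonneg abs_faceWt_le faceSum slotPsiS)
open Summit.QuantumFields.BalabanUV.Beta.SymCorrectorLiteralW (W2OfK_conj_psiKS' loc_dM_of_spr)
open Summit.QuantumFields.BalabanUV.Beta.SymCorrectorFaceGauge (faceFamily_eq_conjV_of_letters vertexOfK_faceFamily_eq_conjV_of_letters abs_blockSymbol_le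
  biLoc_diagK_of_abs_le)
open Summit.QuantumFields.BalabanUV.Beta.SymCorrectorPairGaugeVertex (abs_conjV_diagK_le abs_blockCoeff_le vertex2OfK_slotPsiS₂_eq_add_contacts_of_letters)
open Summit.QuantumFields.BalabanUV.Beta.KernelWardResponse (decays_of_biLoc)
open Summit.QuantumFields.BalabanUV.Beta.SymCorrectorMixedGauge (mixOfK_slotPsiS_eq_add_contact_of_letters)

namespace Summit.QuantumFields.BalabanUV.Beta.SymCorrectorW2Gauge

noncomputable section

variable {d : ℕ} {n : ℕ}

/-! ## §1 Sockets: a localised kernel decays (an2's `decays_of_biLoc`); table bounds; the face gauge generator is localised -/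

/-- [folklore] A localised kernel decays at a positive rate (the `∃`-form `vertexOfK_add` ∕ `vertex2OfK_add_of_bdd` take). -/
theorem decays_of_loc {Y : MKer (d + 1) (Fib d)} (hY : Loc Y) : ∃ δ C : ℝ, 0 < δ ∧ 0 ≤ C ∧ Decays Y C δ := by
  obtain ⟨p, q, C, δ, hδ, h⟩ := hY
  have hC : 0 ≤ C := h.nonneg (Sum.inl 0)
  exact ⟨δ, C * Real.exp (δ * l1 (p - q)), hδ, by positivity, decays_of_biLoc h hδ.le⟩

/-- [folklore] **THE (un-negated) FACE GAUGE GENERATOR IS LOCALISED** for a kernel decaying at a positive rate (TT10 `abs_blockSymbol_le` + `biLoc_diagK_of_abs_le`). -/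
theorem loc_faceGen (hn : 0 < n) {K : MKer (d + 1) (Fib d)} (hK : Spr K) (ϱ : Site (d + 1)) (r : Fin (d + 1) → ℕ) (ξ : ℝ) (μ : Fin (d + 1)) (y : Site (d + 1)) :
    Loc (diagK fun z b => ∑ α : Fin (d + 1), ∑ x ∈ blockSitesF n (blk n (legSite ϱ z b)), colH K n μ y α x * (ξ * faceWt r n α x)) := by
  obtain ⟨C, δ, hδ, hKd⟩ := hK
  have hc : ∀ α x, |ξ * faceWt r n α x| ≤ |ξ| * faceWtSum r n := fun α x => by
    rw [abs_mul]; exact mul_le_mul_of_nonneg_left (abs_faceWt_le hn r α x) (abs_nonneg ξ)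
  exact ⟨(n : ℤ) • y, (n : ℤ) • y, _, δ / 2, half_pos hδ,
    biLoc_diagK_of_abs_le fun z b => abs_blockSymbol_le hn hKd hδ.le ϱ hc (mul_nonneg (abs_nonneg ξ) (faceWtSum_nonneg r n)) μ y z b⟩

/-! ## §2 The first background derivative through ANY decaying kernel, slot-transported; the response kernel is localised -/

section Response

variable (hn : 0 < n) (r : Fin (d + 1) → ℕ)
  {S : Fin (d + 1) → Site (d + 1) → MKer (d + 1) (Fib d)} {Cs δs : ℝ} (hSl : LocStencil S Cs δs) (hδs : 0 < δs)
  {𝕄 : MKer (d + 1) (Fib d)} (hMs : Spr 𝕄) {ϱ : Site (d + 1)} {ξ : ℝ}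
  (hS : ∀ u, divV S u = ξ • conjV 𝕄 (diagK (legInd ϱ u)))
include hn hSl hδs hMs hS

/-- [folklore] **`dM` OF THE SLOT-TRANSPORTED STENCIL THROUGH ANY DECAYING KERNEL**: for `Y` decaying at a positive rate (a spread kernel, or a localised
response kernel by `decays_of_loc`), `dM Y n (slotPsiS r n S) M μ y = dM Y n S M μ y + conjV 𝕄 (Θ[Y] μ y)`,
`Θ[Y] μ y := diagK (z b ↦ Σ_α Σ_{x ∈ blockSitesF n (blk n (legSite ϱ z b))} colH Y n μ y α x·(ξ·faceWt r n α x))` (`vertexOfK_add` on bounded families + TT10). -/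
theorem dM_slotPsiS_eq_add_of_letters {Y : MKer (d + 1) (Fib d)} (hY : ∃ δ C : ℝ, 0 < δ ∧ 0 ≤ C ∧ Decays Y C δ)
    (M : Fin (d + 1) → Site (d + 1) → MKer (d + 1) (Fib d)) (μ : Fin (d + 1)) (y : Site (d + 1)) :
    dM Y n (slotPsiS r n S) M μ y
      = dM Y n S M μ y
        + conjV 𝕄 (diagK fun z b => ∑ α : Fin (d + 1), ∑ x ∈ blockSitesF n (blk n (legSite ϱ z b)), colH Y n μ y α x * (ξ * faceWt r n α x)) := by
  obtain ⟨CM', δM', hδM', hMd⟩ := hMs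
  have hMb : ∀ p q a c, |𝕄 p q a c| ≤ CM' := fun p q a c => (hMd p q a c).trans (by
    have h1 : Real.exp (-δM' * l1 (p - q)) ≤ 1 := by rw [Real.exp_le_one_iff]; nlinarith [l1_nonneg (p - q)]
    nlinarith [hMd.nonneg (Sum.inl 0)])
  set B : ℝ := Cs + CM' * (2 * (|ξ| * faceWtSum r n)) with hB
  have hF : 0 ≤ CM' * (2 * (|ξ| * faceWtSum r n)) := by
    have h1 : 0 ≤ CM' := (abs_nonneg _).trans (hMb 0 0 (Sum.inl 0) (Sum.inl 0))
    have h2 := faceWtSum_nonneg r n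
    positivity
  have hCs : 0 ≤ Cs := (hSl 0 0).nonneg (Sum.inl 0)
  have b1 : ∀ κ u p q a c, |S κ u p q a c| ≤ B := fun κ u p q a c => (abs_le_of_locStencil hSl hδs.le κ u p q a c).trans (by linarith)
  have eF : (fun α x => faceWt r n α x • faceSum n S (blk n x))
      = fun α x => conjV 𝕄 (diagK fun z b => if blk n (legSite ϱ z b) = blk n x then ξ * faceWt r n α x else 0) :=
    funext fun α => funext fun x => faceFamily_eq_conjV_of_letters hn hS r α x
  have b2 : ∀ κ u p q a c, |(fun α x => faceWt r n α x • faceSum n S (blk n x)) κ u p q a c| ≤ B := by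
    intro κ u p q a c
    rw [eF]
    exact (abs_conjV_diagK_le hMb (fun z b => abs_blockCoeff_le hn r ϱ ξ κ u z b) p q a c).trans (by linarith)
  have e1 : vertexOfK Y n (slotPsiS r n S) μ y = vertexOfK Y n S μ y + vertexOfK Y n (fun α x => faceWt r n α x • faceSum n S (blk n x)) μ y :=
    vertexOfK_add (N := n) hY b1 b2 μ y
  show vertexOfK Y n (slotPsiS r n S) μ y + vertexOfM Y n M μ y = (vertexOfK Y n S μ y + vertexOfM Y n M μ y) + _
  rw [e1, vertexOfK_faceFamily_eq_conjV_of_letters hn hS Y r μ y]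
  abel

variable {r} (hr : r ∈ box (d + 1) n) {K : MKer (d + 1) (Fib d)} (hK : Spr K)
  {M : Fin (d + 1) → Site (d + 1) → MKer (d + 1) (Fib d)} {CM δM : ℝ} (hMv : VertexFamily M n CM δM) (hδM : 0 < δM)
include hr hK hMv hδM

omit hS in
/-- [folklore] **THE RESPONSE KERNEL WITH THE INNER SLOT TRANSPORTED IS LOCALISED**: `Loc (−(K∘(Ψ̂ᵀ∘(dM K n S M ν y′ + conjV 𝕄 (Θ[K] ν y′))∘Ψ̂)∘K))`
(TT8 `loc_dM_of_spr`, `loc_conjV` + §1 `loc_faceGen`, then the `Ψ̂`∕`K` dressings as in TT6 `loc_inner`). -/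
theorem loc_responseKernel (ν : Fin (d + 1)) (y' : Site (d + 1)) :
    Loc (-(comp (comp K (comp (comp (trK (psiKS r n))
        (dM K n S M ν y' + conjV 𝕄 (diagK fun z b => ∑ α : Fin (d + 1), ∑ x ∈ blockSitesF n (blk n (legSite ϱ z b)), colH K n ν y' α x * (ξ * faceWt r n α x))))
        (psiKS r n))) K)) := by
  haveI : NeZero n := ⟨hn.ne'⟩
  have hD : Loc (dM K n S M ν y' + conjV 𝕄 (diagK fun z b => ∑ α : Fin (d + 1), ∑ x ∈ blockSitesF n (blk n (legSite ϱ z b)), colH K n ν y' α x * (ξ * faceWt r n α x))) :=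
    (loc_dM_of_spr hK hSl hδs hMv hδM ν y').add (loc_conjV hMs (loc_faceGen hn hK ϱ r ξ ν y'))
  exact ((hK.comp_loc (((spr_psiKS hn hr).trK.comp_loc hD).comp_spr (spr_psiKS hn hr))).comp_spr hK).neg

end Response

/-! ## §3 The transported second-order family: raw words + `Wmix`-pieces + `Wgg`-piece + the displayed response contact -/

section Whole

variable (hn : 0 < n) {r : Fin (d + 1) → ℕ} (hr : r ∈ box (d + 1) n) {K : MKer (d + 1) (Fib d)} (hK : Spr K)
  {S : Fin (d + 1) → Site (d + 1) → MKer (d + 1) (Fib d)} {Cs δs : ℝ} (hSl : LocStencil S Cs δs) (hδs : 0 < δs)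
  {M : Fin (d + 1) → Site (d + 1) → MKer (d + 1) (Fib d)} {CM δM : ℝ} (hMv : VertexFamily M n CM δM) (hδM : 0 < δM)
  {S₂ : Fin (d + 1) → Site (d + 1) → Fin (d + 1) → Site (d + 1) → MKer (d + 1) (Fib d)} {C₂ δ₂ : ℝ} (hS₂ : LocStencil₂ S₂ C₂ δ₂) (hδ₂ : 0 < δ₂)
  {M₂ : Fin (d + 1) → Site (d + 1) → Fin (d + 1) → Site (d + 1) → MKer (d + 1) (Fib d)} {CF δF : ℝ} (hM₂ : LocStencilFM n M₂ CF δF) (hδF : 0 < δF)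
  {𝕄 : MKer (d + 1) (Fib d)} (hMs : Spr 𝕄) {ϱ : Site (d + 1)} {ξ ξ₁ ξ₂ ξm : ℝ}
  (hS : ∀ u, divV S u = ξ • conjV 𝕄 (diagK (legInd ϱ u)))
  (hL : ∀ κ' u' u, divV (fun κ u => S₂ κ u κ' u') u = ξ₁ • conjV (S κ' u') (diagK (legInd ϱ u)))
  (hR : ∀ α x u', divV (S₂ α x) u' = ξ₂ • conjV (S α x) (diagK (legInd ϱ u')))
  (hMl : ∀ ρ w u', divV (fun κ u => M₂ κ u ρ w) u' = ξm • conjV (M ρ w) (diagK (legInd ϱ u')))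
include hn hr hK hSl hδs hMv hδM hS₂ hδ₂ hM₂ hδF hMs hS hL hR hMl

/-- [folklore] **THE SECOND-ORDER FAMILY OF THE CHART-TRANSPORTED KERNEL AS GAUGE LETTERS**: for a spread `K`, an in-block root offset `r` (`Ψ̂ := psiKS r n`),
localised tables, a spread letter partner `𝕄` and the four pointwise rooted slot letters,
`W2OfK (Ψ̂KΨ̂ᵀ) n S M S₂ M₂ μ y ν y′ = (vertex2OfK K n S₂ + mixOfK K n M₂ + mixOfK K n M₂ (swapped) + dM Y′ n S M) + (Wmix-pieces) + (Wgg-piece) + conjV 𝕄 (Θ[Y′] μ y)`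
— see the module docstring for the display; the response word `dM Y′ n S M μ y` and the last contact are what is NOT a letter of `hessKer_columnGauge`. -/
theorem W2OfK_conj_psiKS_eq_add_gauge_letters (μ : Fin (d + 1)) (y : Site (d + 1)) (ν : Fin (d + 1)) (y' : Site (d + 1)) :
    W2OfK (comp (comp (psiKS r n) K) (trK (psiKS r n))) n S M S₂ M₂ μ y ν y'
      = (vertex2OfK K n S₂ μ y ν y' + mixOfK K n M₂ μ y ν y' + mixOfK K n M₂ ν y' μ y
          + dM (-(comp (comp K (comp (comp (trK (psiKS r n))
              (dM K n S M ν y' + conjV 𝕄 (diagK fun z b => ∑ α : Fin (d + 1), ∑ x ∈ blockSitesF n (blk n (legSite ϱ z b)), colH K n ν y' α x * (ξ * faceWt r n α x))))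
              (psiKS r n))) K)) n S M μ y)
        + ((conjV (vertexOfK K n S ν y') (diagK fun z b => ∑ α : Fin (d + 1), ∑ x ∈ blockSitesF n (blk n (legSite ϱ z b)), colH K n μ y α x * (ξ₁ * faceWt r n α x))
            + conjV (vertexOfK K n S μ y) (diagK fun z b => ∑ κ' : Fin (d + 1), ∑ u' ∈ blockSitesF n (blk n (legSite ϱ z b)), colH K n ν y' κ' u' * (ξ₂ * faceWt r n κ' u')))
          + (conjV (vertexOfM K n M ν y') (diagK fun z b => ∑ α : Fin (d + 1), ∑ x ∈ blockSitesF n (blk n (legSite ϱ z b)), colH K n μ y α x * (ξm * faceWt r n α x))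
            + conjV (vertexOfM K n M μ y) (diagK fun z b => ∑ α : Fin (d + 1), ∑ x ∈ blockSitesF n (blk n (legSite ϱ z b)), colH K n ν y' α x * (ξm * faceWt r n α x))))
        + conjV (conjV 𝕄 (diagK fun z b => ∑ κ' : Fin (d + 1), ∑ u' ∈ blockSitesF n (blk n (legSite ϱ z b)), colH K n ν y' κ' u' * (ξ * faceWt r n κ' u')))
            (diagK fun z b => ∑ α : Fin (d + 1), ∑ x ∈ blockSitesF n (blk n (legSite ϱ z b)), colH K n μ y α x * (ξ₁ * faceWt r n α x))
        + conjV 𝕄 (diagK fun z b => ∑ α : Fin (d + 1), ∑ x ∈ blockSitesF n (blk n (legSite ϱ z b)),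
            colH (-(comp (comp K (comp (comp (trK (psiKS r n))
              (dM K n S M ν y' + conjV 𝕄 (diagK fun z' b' => ∑ α' : Fin (d + 1), ∑ x' ∈ blockSitesF n (blk n (legSite ϱ z' b')), colH K n ν y' α' x' * (ξ * faceWt r n α' x'))))
              (psiKS r n))) K)) n μ y α x * (ξ * faceWt r n α x)) := by
  haveI : NeZero n := ⟨hn.ne'⟩
  obtain ⟨CM', δM', hδM', hMd⟩ := id hMs
  have bMM : ∀ p q a c, |𝕄 p q a c| ≤ CM' := fun p q a c => (hMd p q a c).trans (by
    have h1 : Real.exp (-δM' * l1 (p - q)) ≤ 1 := by rw [Real.exp_le_one_iff]; nlinarith [l1_nonneg (p - q)]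
    nlinarith [hMd.nonneg (Sum.inl 0)])
  have bS : ∀ κ u p q a c, |S κ u p q a c| ≤ Cs := fun κ u p q a c => abs_le_of_locStencil hSl hδs.le κ u p q a c
  have bM : ∀ ρ w p q a e, |M ρ w p q a e| ≤ CM := fun ρ w p q a e => bdd_of_biLoc (hMv ρ w) hδM.le p q a e
  have hKdec : ∃ δ C : ℝ, 0 < δ ∧ 0 ≤ C ∧ Decays K C δ := by
    obtain ⟨C, δ, hδ, hKd⟩ := hK; exact ⟨δ, C, hδ, hKd.nonneg (Sum.inl 0), hKd⟩
  have hY' := decays_of_loc (loc_responseKernel (ϱ := ϱ) (ξ := ξ) hn hSl hδs hMs hr hK hMv hδM ν y')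
  rw [W2OfK_conj_psiKS' hn hr hK hSl hδs hMv hδM hS₂ hδ₂ hM₂ hδF μ y ν y',
    vertex2OfK_slotPsiS₂_eq_add_contacts_of_letters hn r hK hS₂ hδ₂ bS bS bMM hL hR hS μ y ν y',
    mixOfK_slotPsiS_eq_add_contact_of_letters hn r hK hM₂ hδF bM hMl μ y ν y',
    mixOfK_slotPsiS_eq_add_contact_of_letters hn r hK hM₂ hδF bM hMl ν y' μ y,
    dM_slotPsiS_eq_add_of_letters hn r hSl hδs hMs hS hKdec M ν y',
    dM_slotPsiS_eq_add_of_letters hn r hSl hδs hMs hS hY' M μ y]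
  abel

end Whole

end

end Summit.QuantumFields.BalabanUV.Beta.SymCorrectorW2Gauge
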